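import Summits.HubbardSuperconductivity.HubbardSuperconductivity.Theorems.AnisotropyChordTransferFibre3GreenZero

/-!
# Route `AnisotropyChord` / H0 rotor rung: the smallness of the ground two-magnon eigenvalue (regime facts of PartN31)

Memo ROTOR-THEORY-21 §302(c)(ii) (theory seat `hubbard-h0-rotor-theory-1`): for the ground profile (`IsGroundTwoMagnon`),
* **`lam2_le`**: minimality tested on `g = 1 − δ₀` gives `λ₂·(V − 1) ≤ 4(1 − Δ)` (`L ≥ 3`; `Q(1 − δ₀) = 4(1−Δ)` exactly);
* **`lam2_sum_rule`**: `λ₂·V = 4(1 − Δ)·f(x̂)` (the `k = 0` case of `TwoMagnonFourier`, `L ≥ 3`), hence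
  **`lam2_pos`** (`Δ < 1 ⇒ 0 < λ₂`) and **`etaEff_eq`**: `η_eff = (1 − Δ) f(x̂)`, **`etaEff_le`**: `η_eff ≤ (1−Δ)·V/(V−1)`.
These are the "all the smallness the one-loop layer uses" facts; `T⁺ < 2ε₁` and `0 < m` remain hypotheses of the assembly
(they need the (KT-1) loop analysis).
Prover seat `hubbard-h0-rotor-p1` g22; helper for stmt-HubbardSuperconductivity-19089 (`--supports`).
-/

set_option linter.dupNamespace false
set_option autoImplicit false

noncomputable section

open scoped BigOperators
open Complex

namespace Summit.HubbardSuperconductivity.HubbardSuperconductivity.Theorems.AnisotropyChord.Transfer.Fibre3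

variable (L : ℕ) [NeZero L]

/-! ## Counting facts -/

/-- the four nearest-neighbour vectors: `Σ_r 1_NN(r) = 4` (`L ≥ 3`). [folklore] -/
theorem sum_nnInd (hL : 3 ≤ L) : ∑ r : Tor L, nnInd L r = 4 := by
  classical
  obtain ⟨d1, d2, d3, d4, d5, d6⟩ := nn_distinct L hL
  unfold nnInd
  rw [Finset.sum_boole, filter_isNN]
  rw [Finset.card_insert_of_notMem (by simp [d1, d2, d3]), Finset.card_insert_of_notMem (by simp [d4, d5]),
    Finset.card_insert_of_notMem (by simp [d6]), Finset.card_singleton]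
  norm_num

omit [NeZero L] in
/-- the origin is not a nearest-neighbour vector (`L ≥ 2`). [folklore] -/
theorem isNN_zero (hL : 2 ≤ L) : IsNN L 0 = false := by
  obtain ⟨hx, hy, _⟩ := exy_ne L hL
  have h1 : -ex L ≠ 0 := neg_ne_zero.mpr hx
  have h2 : -ey L ≠ 0 := neg_ne_zero.mpr hy
  by_contra h
  have h' : IsNN L 0 = true := by simpa using h
  rcases eq_of_isNN L h' with e | e | e | e
  · exact hx e.symm
  · exact h1 e.symm
  · exact hy e.symm
  · exact h2 e.symm

/-! ## `λ₂ (V − 1) ≤ 4(1 − Δ)` -/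

/-- **the minimality bound `λ₂·(V − 1) ≤ 4(1 − Δ)`** (test function `1 − δ₀`; `L ≥ 3`). [folklore] -/
theorem lam2_le (hL : 3 ≤ L) {Δ lam2 : ℝ} {f : Tor L → ℝ} (hf : IsGroundTwoMagnon L Δ lam2 f) :
    lam2 * ((L : ℝ) ^ 2 - 1) ≤ 4 * (1 - Δ) := by
  classical
  have hL2 : 2 ≤ L := by omega
  obtain ⟨_, _, hmin⟩ := hf
  set g : Tor L → ℝ := fun r => if r = 0 then 0 else 1 with hg
  have hg0 : g 0 = 0 := by simp [hg]
  have h := hmin g hg0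
  -- Σ g² = V − 1
  have hcard : (Fintype.card (Tor L) : ℝ) = (L : ℝ) ^ 2 := by
    rw [Fintype.card_prod, ZMod.card]; push_cast; ring
  have hsumg : ∑ r : Tor L, g r = (L : ℝ) ^ 2 - 1 := by
    have : ∀ r : Tor L, g r = 1 - (if r = 0 then 1 else 0) := by
      intro r; simp only [hg]; split_ifs <;> simp
    rw [Finset.sum_congr rfl fun r _ => this r, Finset.sum_sub_distrib, Finset.sum_const, Finset.sum_ite_eq' Finset.univ (0 : Tor L)]
    simp only [Finset.mem_univ, if_true, Finset.card_univ, nsmul_eq_mul, mul_one]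
    rw [hcard]
  have hsq : ∑ r : Tor L, g r ^ 2 = (L : ℝ) ^ 2 - 1 := by
    rw [← hsumg]; refine Finset.sum_congr rfl fun r _ => ?_; simp only [hg]; split_ifs <;> norm_num
  -- Q(g) = 4(1 − Δ)
  have hQ : twoMagnonQF L Δ g = 4 * (1 - Δ) := by
    rw [twoMagnonQF_eq]
    -- the diagonal part
    have hdiag : ∑ r : Tor L, (4 - Δ * nnInd L r) * g r ^ 2 = 4 * ((L : ℝ) ^ 2 - 1) - 4 * Δ := by
      have hpt : ∀ r : Tor L, (4 - Δ * nnInd L r) * g r ^ 2 = 4 * g r - Δ * nnInd L r := by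
        intro r
        by_cases hr : r = 0
        · rw [hr, hg0]; unfold nnInd; rw [isNN_zero L hL2]; simp
        · simp only [hg, hr, if_false]; ring
      rw [Finset.sum_congr rfl fun r _ => hpt r, Finset.sum_sub_distrib, ← Finset.mul_sum, ← Finset.mul_sum, hsumg,
        sum_nnInd L hL]
      ring
    -- the hopping part
    have hshift : ∀ e : Tor L, ∑ r : Tor L, g (r + e) = ∑ r : Tor L, g r :=
      fun e => Fintype.sum_equiv (Equiv.addRight e) _ _ fun r => rfl
    have hnb0 : nbSum L g 0 = 4 := by
      obtain ⟨hx, hy, _⟩ := exy_ne L hL2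
      unfold nbSum
      simp only [hg, zero_add, hx, hy, neg_eq_zero, if_false]
      norm_num
    have hhop : ∑ r : Tor L, g r * nbSum L g r = 4 * ((L : ℝ) ^ 2 - 1) - 4 := by
      have hpt : ∀ r : Tor L, g r * nbSum L g r = nbSum L g r - (if r = 0 then nbSum L g r else 0) := by
        intro r; simp only [hg]; split_ifs <;> ring
      rw [Finset.sum_congr rfl fun r _ => hpt r, Finset.sum_sub_distrib, Finset.sum_ite_eq' Finset.univ (0 : Tor L)]
      simp only [Finset.mem_univ, if_true]
      rw [hnb0]
      unfold nbSum
      rw [Finset.sum_add_distrib, Finset.sum_add_distrib, Finset.sum_add_distrib, hshift, hshift, hshift, hshift, hsumg]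
      ring
    rw [Finset.sum_sub_distrib, hdiag, hhop]
    ring
  rw [hsq, hQ] at h
  exact h

/-! ## The sum rule and its consequences -/

/-- **the sum rule `λ₂·V = 4(1−Δ)·f(x̂)`** (the `k = 0` Fourier identity; `L ≥ 3`). [folklore] -/
theorem lam2_sum_rule (hL : 3 ≤ L) {Δ lam2 : ℝ} {f : Tor L → ℝ} (hf : IsTwoMagnon L Δ lam2 f) :
    lam2 * (L : ℝ) ^ 2 = 4 * (1 - Δ) * f (K1 L) := by
  obtain ⟨h0, hnn, _, hsum, heq⟩ := hf
  have h := twoMagnonFourier_holds L hL Δ lam2 f h0 hnn heq 0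
  rw [epsT_zero, dft_zero, hsum] at h
  have h' : (((2 * 0 - lam2) * (L : ℝ) ^ 2 : ℝ) : ℂ) = ((-(f (K1 L) * (4 * (1 - Δ) + 2 * Δ * 0)) : ℝ) : ℂ) := by
    push_cast at h ⊢; linear_combination h
  have h'' := Complex.ofReal_injective h'
  linarith

/-- **`λ₂ > 0` for `Δ < 1`** (`L ≥ 3`). [folklore] -/
theorem lam2_pos (hL : 3 ≤ L) {Δ lam2 : ℝ} (hΔ : Δ < 1) {f : Tor L → ℝ} (hf : IsTwoMagnon L Δ lam2 f) : 0 < lam2 := by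
  have h := lam2_sum_rule L hL hf
  have hfnn : 0 < f (K1 L) := hf.2.2.1
  have hV : (0 : ℝ) < (L : ℝ) ^ 2 := by
    have : (0 : ℝ) < L := by exact_mod_cast (show 0 < L by omega)
    positivity
  have : 0 < lam2 * (L : ℝ) ^ 2 := by rw [h]; exact mul_pos (by linarith) hfnn
  exact pos_of_mul_pos_left this hV.le

/-- **`η_eff = (1 − Δ)·f(x̂)`** (`L ≥ 3`). [folklore] -/
theorem etaEff_eq (hL : 3 ≤ L) {Δ lam2 : ℝ} {f : Tor L → ℝ} (hf : IsTwoMagnon L Δ lam2 f) :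
    etaEff L lam2 = (1 - Δ) * f (K1 L) := by
  unfold etaEff
  have h := lam2_sum_rule L hL hf
  linarith

/-- **`η_eff ≤ (1 − Δ)·V/(V − 1)`** for the ground profile (`L ≥ 3`). [folklore] -/
theorem etaEff_le (hL : 3 ≤ L) {Δ lam2 : ℝ} {f : Tor L → ℝ} (hf : IsGroundTwoMagnon L Δ lam2 f) :
    etaEff L lam2 ≤ (1 - Δ) * (L : ℝ) ^ 2 / ((L : ℝ) ^ 2 - 1) := by
  have h := lam2_le L hL hf
  have hV : (1 : ℝ) < (L : ℝ) ^ 2 := by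
    have : (3 : ℝ) ≤ L := by exact_mod_cast hL
    nlinarith
  unfold etaEff
  rw [le_div_iff₀ (by linarith)]
  nlinarith

end Summit.HubbardSuperconductivity.HubbardSuperconductivity.Theorems.AnisotropyChord.Transfer.Fibre3

end
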